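import Literature.AlgebraicGeometry.Motives.AbelianVarietyTateModuleAlong
import Literature.AlgebraicGeometry.Motives.AbelianVarietyBaseChange
import Literature.AlgebraicGeometry.Motives.BaseChange
import Literature.AlgebraicGeometry.AbelianSchemes.AbelianSchemeOverFibreIdentity
import Literature.AlgebraicGeometry.Motives.AbelianVarietyPolarizationTypeAnalytic
import HarnessLib

/-!
# The type of the polarisation `φ_Θ` of a complex abelian variety is the analytic type of `c₁(𝒪(Θ)^an)`
# ([MFK94] App. 7A «`ker(λ) ≅ ∏ ℤ/δᵢℤ × ∏ μ_{δᵢ}`»; [Lange 2023] §3.2.1 `K(H) ≅ (ℤ^g/Dℤ^g)²`; [Mumford AV] §23)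

Layer `Literature/AlgebraicGeometry/AbelianVarieties`, namespace `Literature.AlgebraicGeometry.AbelianVarieties`.
THEOREMS ONLY (no definition, no named fact, no instance, no `sorry`).  Cell `hodgecm-mathlib` (D-0151), U-DAG §2 node
U-a4 (F2) = the cell's socket `AbelianSchemeOver.Polarization.hasType_of_complexTorus_isPolarizationType` (v2) proved as a
theorem (hand B-p18 (g14)); the converse companion of ★ `HasType.complexTorus_isPolarizationType`
(`Motives/AbelianVarietyPolarizationTypeAnalytic`).  HC_CM is proved only modulo the printed citations until rung 0 closes.

Setting: a complex abelian variety `A₀`, a group-law compatible uniformisation `φ : V/Φ(ℤ^κ) → A₀(ℂ)`, a divisor `Θ₀` with an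
Appell–Humbert datum `p` of `[𝒪(Θ₀)^an]` whose form is a Riemann form of ANALYTIC type `δ`, and a polarisation `pol` of
`ofAbelianVariety A₀` w.r.t. ANY dual pair `D` with `λ̄ = Λ(𝒪(Θ₁))` at the identity point for some `Θ₁` on `A₁ = A ×_ℂ Spec ℂ`
with `[Θ₁] = pr₁^*[Θ₀]` (what ★ `exists_polarization_of_dualPair` exports).
* `exists_idFibre_pointsHom`, `mem_KTheta_idFibre_iff` — `K(Θ₁)(A₁) ↔ K(Θ₀)(A₀)` under `pr₁`; `isPolarizationType_of_complexTorus_isPolarizationType`;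
  `nonempty_levelGroup_mulEquiv_KTheta` (`(∏ᵢ ℤ/δᵢ)² ≃ K(H) ≃ K(Θ₀)(ℂ)`); `exists_monoidHom_range_eq_kerPointsAt_id` (the clause
  at the identity point); `exists_extendScalars_eq_of_pow_eq_one` (torsion does not grow from `ℂ` to `Ω`);
  `fibrePointsExtend_mem_kerPointsAt_iff`, `exists_fibrePointsExtend_eq_of_mem_kerPointsAt` (at `s = Spec σ` the extension of
  points `A₁(ℂ) → A_s(Ω)` carries `ker λ̄(ℂ)` onto `ker λ̄(Ω)`: `Spec Ω → Spec ℂ` is epi, ★ `AlgPoints.epi_specMap_algebraMap`;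
  `ker λ̄(Ω) = K(Θ_s)(Ω)` is finite of exponent `#K(Θ_s)`, ★ `pow_natCard_KTheta_eq_one`);
* **`hasType_of_complexTorus_isPolarizationType`** — HEAD: `pol.HasType δ`.

Design: NO definitions — the plumbing homomorphisms of points `j = pr₁ : A₁(ℂ) → A₀(ℂ)`, `j' = pr₁⁻¹`, `E : A₁(ℂ) → A_s(Ω)`
(composites of ★ `Hom.pointsAddHom` / ★ `AlgPoints.extendScalarsMonoidHom` / ★ `pointsMulEquiv`) enter the lemmas as BINDERS
pinned down pointwise (`hj : ∀ P, j P = P ≫ pr₁`, `hj'`, `hE`) and are constructed once (`exists_idFibre_pointsHom`, the head's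
proof); spelling through `ofAbelianVariety A₀` as in ★ `PolarizationOfAmpleDivisor`.

## References
* [MumfordFogartyKirwan1994] Mumford–Fogarty–Kirwan, *GIT* (3rd ed. 1994), App. 7A pp. 234–235 («`ker(λ) ≅ ∏ ℤ/δᵢℤ × ∏ μ_{δᵢ}`»).
* [Lange2023AbelianVarietiesComplex] H. Lange, *Abelian Varieties over the Complex Numbers* (2023), §1.4.2 (1.14), §1.5.1, §3.2.1 p. 165.
* [MumfordAV1970] D. Mumford, *Abelian Varieties* (1970), §6 (Application 1; Proposition p. 64), §23.
* [GortzWedhorn2020] Görtz–Wedhorn, *Algebraic Geometry I* (2nd ed. 2020), Section (4.7); [Hartshorne1977] II Ex. 2.7, Ex. 6.8.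
-/

set_option autoImplicit false

noncomputable section

open CategoryTheory CategoryTheory.Limits AlgebraicGeometry Function
open Literature.AlgebraicGeometry.Motives Literature.AlgebraicGeometry.Modules
open Literature.AlgebraicGeometry.AbelianSchemes
open Literature.Geometry.Kaehler Literature.Geometry.Kaehler.ComplexTorus
open Literature.NumberTheory.Transcendental Literature.AlgebraicGeometry.HodgeTheory
open scoped MonObj

namespace Literature.AlgebraicGeometry.AbelianVarieties

open AbelianSchemeOver

section IdFibre

/-- `(f ≫ g)^* = f^* ∘ g^*` on `Ȟ¹(–, 𝒪^×)` (★ `CechPic.pullback_comp`, re-proved privately to keep the import cone small, as in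
★ `PoincareSheafSlices`). [cite: Hartshorne1977, II Ex. 6.8 (functoriality of f^* on Pic)] -/
private theorem cechPic_pullback_comp {X Y Z : Scheme} (f : X ⟶ Y) (g : Y ⟶ Z) (c : CechPic Z) :
    CechPic.pullback (f ≫ g) c = CechPic.pullback f (CechPic.pullback g c) := by
  obtain ⟨c, rfl⟩ := CechPic.mk_surjective c
  rw [CechPic.pullback_mk, CechPic.pullback_mk, CechPic.pullback_mk]
  refine CechPic.sound (UnitCocycle.equiv_of_eq _ _
    (fun x => f ⁻¹ᵁ (g ⁻¹ᵁ c.U (g.base (f.base x)))) (fun x => c.mem (g.base (f.base x)))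
    (fun x => le_of_eq rfl) (fun x => le_rfl) fun x y V hx hy => ?_)
  change (g.appLE _ _ _ ≫ f.appLE _ V _) (c.g _ _ _ _ _) = (f ≫ g).appLE _ V _ (c.g _ _ _ _ _)
  rw [Scheme.Hom.appLE_comp_appLE]
  rfl

/-- `(𝟙 X)^* = id` on `Ȟ¹(X, 𝒪^×)` (★ `cechPic_pullback_id` of `AbelianVarieties/PoincareSheafOfPrincipal`, re-proved
privately to keep the import cone small). [cite: Hartshorne1977, II Ex. 6.8 (functoriality of f^* on Pic)] -/
private theorem cechPic_pullback_id {X : Scheme} (c : CechPic X) : CechPic.pullback (𝟙 X) c = c := by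
  obtain ⟨c, rfl⟩ := CechPic.mk_surjective c
  rw [CechPic.pullback_mk]
  refine CechPic.sound (UnitCocycle.equiv_of_eq _ _ c.U c.mem
    (fun x => le_of_eq (TopologicalSpace.Opens.map_id_obj _).symm) (fun x => le_rfl) fun x y V hx hy => ?_)
  change c.g x y V _ _ = (𝟙 X : X ⟶ X).appLE _ V _ (c.g _ _ _ _ _)
  rw [Scheme.Hom.appLE]
  erw [Category.id_comp]
  exact (c.map_g x y inf_le_left inf_le_right (le_inf hx hy : V ≤ c.U x ⊓ c.U y)).symm

variable (A₀ : AbelianVariety ℂ)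

/-- **The points homomorphisms of the identity-fibre isomorphism**: `pr₁ : A₁(ℂ) → A₀(ℂ)` and `pr₁⁻¹`, acting by composition
with ★ `fibreIdIso` (★ `AbelianVariety.Hom.pointsAddHom` read multiplicatively).  The plumbing homomorphisms of this file are
theorem binders pinned down pointwise (`hj`, `hj'`, `hE`); this is their construction. [cite: GortzWedhorn2020, Section (4.7) (p. 135)] -/
theorem exists_idFibre_pointsHom :
    ∃ (j : ((ofAbelianVariety A₀).fibre (𝟙 (Spec (CommRingCat.of ℂ)))).toAbelianVariety.Points ℂ →* A₀.Points ℂ)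
      (j' : A₀.Points ℂ →* ((ofAbelianVariety A₀).fibre (𝟙 (Spec (CommRingCat.of ℂ)))).toAbelianVariety.Points ℂ),
      (∀ P, j P = AlgPoints.map (fibreIdIso (ofAbelianVariety A₀)).hom.hom.hom.hom P) ∧
        ∀ Q, j' Q = AlgPoints.map (fibreIdIso (ofAbelianVariety A₀)).inv.hom.hom.hom Q :=
  ⟨AddMonoidHom.toMultiplicative (AbelianVariety.Hom.pointsAddHom ℂ (fibreIdIso (ofAbelianVariety A₀)).hom),
    AddMonoidHom.toMultiplicative (AbelianVariety.Hom.pointsAddHom ℂ (fibreIdIso (ofAbelianVariety A₀)).inv),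
    fun _ => rfl, fun _ => rfl⟩

variable (j : ((ofAbelianVariety A₀).fibre (𝟙 (Spec (CommRingCat.of ℂ)))).toAbelianVariety.Points ℂ →* A₀.Points ℂ)
  (j' : A₀.Points ℂ →* ((ofAbelianVariety A₀).fibre (𝟙 (Spec (CommRingCat.of ℂ)))).toAbelianVariety.Points ℂ)
  (hj : ∀ P, j P = AlgPoints.map (fibreIdIso (ofAbelianVariety A₀)).hom.hom.hom.hom P)
  (hj' : ∀ Q, j' Q = AlgPoints.map (fibreIdIso (ofAbelianVariety A₀)).inv.hom.hom.hom Q)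

include hj

/-- **`K(Θ₁)` on the identity fibre corresponds to `K(Θ₀)` on `A₀` under `pr₁`**, for any divisor `Θ₁` on `A₁` with
`[Θ₁] = pr₁^*[Θ₀]`: `K(Θ) = {x ; [t_x^*Θ] = [Θ]}` ([MumfordAV1970] §6), translations intertwine (`t_P ≫ pr₁ = pr₁ ≫ t_{pr₁ P}`,
★ `AbelianVariety.translation_comp_hom`) and `pr₁^*` is injective on `Ȟ¹(·, 𝒪^×)` (`pr₁` is an isomorphism).
[cite: MumfordAV1970, §6 Definition of K(L) (p. 60)] [cite: GortzWedhorn2020, Section (4.7) (p. 135)] -/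
theorem mem_KTheta_idFibre_iff (Θ₀ : CartierDivisor A₀.X.left)
    (Θ₁ : CartierDivisor ((ofAbelianVariety A₀).fibre (𝟙 (Spec (CommRingCat.of ℂ)))).toAbelianVariety.X.left)
    (hΘ₁ : Θ₁.cechClass = CechPic.pullback
      (pullback.fst (ofAbelianVariety A₀).X.hom (𝟙 (Spec (CommRingCat.of ℂ)))) Θ₀.cechClass)
    (P : ((ofAbelianVariety A₀).fibre (𝟙 (Spec (CommRingCat.of ℂ)))).toAbelianVariety.Points ℂ) :
    P ∈ ((ofAbelianVariety A₀).fibre (𝟙 (Spec (CommRingCat.of ℂ)))).toAbelianVariety.KTheta Θ₁ ↔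
      j P ∈ A₀.KTheta Θ₀ := by
  have e4 : (fibreIdIso (ofAbelianVariety A₀)).hom.hom.hom.hom.left =
      pullback.fst (ofAbelianVariety A₀).X.hom (𝟙 (Spec (CommRingCat.of ℂ))) :=
    fibreIdToGrpIso_hom_left _
  -- translations intertwine: `t_P ≫ pr₁ = pr₁ ≫ t_{pr₁ P}`
  have ht : (((ofAbelianVariety A₀).fibre (𝟙 (Spec (CommRingCat.of ℂ)))).toAbelianVariety.translation P).left ≫
        pullback.fst (ofAbelianVariety A₀).X.hom (𝟙 (Spec (CommRingCat.of ℂ))) =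
      pullback.fst (ofAbelianVariety A₀).X.hom (𝟙 (Spec (CommRingCat.of ℂ))) ≫ (A₀.translation (j P)).left := by
    have h : ((((ofAbelianVariety A₀).fibre (𝟙 (Spec (CommRingCat.of ℂ)))).toAbelianVariety.translation P) ≫
        (fibreIdIso (ofAbelianVariety A₀)).hom.hom.hom.hom).left =
        ((fibreIdIso (ofAbelianVariety A₀)).hom.hom.hom.hom ≫ A₀.translation (j P)).left := by
      rw [hj P]
      exact congrArg CommaMorphism.left (AbelianVariety.translation_comp_hom (fibreIdIso (ofAbelianVariety A₀)).hom P)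
    rw [Over.comp_left, Over.comp_left, e4] at h
    exact h
  -- `pr₁^*` is injective on classes
  have hinj : Injective (CechPic.pullback (pullback.fst (ofAbelianVariety A₀).X.hom (𝟙 (Spec (CommRingCat.of ℂ))))) := by
    haveI := isIso_pullback_fst_id (ofAbelianVariety A₀).X
    intro x y hxy
    have h := congrArg (CechPic.pullback (inv (pullback.fst (ofAbelianVariety A₀).X.hom (𝟙 (Spec (CommRingCat.of ℂ)))))) hxy
    rwa [← cechPic_pullback_comp, ← cechPic_pullback_comp, IsIso.inv_hom_id,
      cechPic_pullback_id, cechPic_pullback_id] at h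
  rw [AbelianVariety.mem_KTheta_iff', AbelianVariety.mem_KTheta_iff', ← CartierDivisor.cechClass_eq_iff_linEquiv,
    ← CartierDivisor.cechClass_eq_iff_linEquiv, CartierDivisor.cechClass_pullback, CartierDivisor.cechClass_pullback, hΘ₁]
  constructor
  · intro h
    apply hinj
    erw [← cechPic_pullback_comp, ← ht, cechPic_pullback_comp]
    exact h
  · intro h
    erw [← cechPic_pullback_comp, ht, cechPic_pullback_comp, h]
    rfl

include hj'

/-- `pr₁ (pr₁⁻¹ Q) = Q` on `ℂ`-points. [cite: GortzWedhorn2020, Section (4.7) (p. 135)] -/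
theorem idFibre_pointsHom_inv_cancel (Q : A₀.Points ℂ) : j (j' Q) = Q := by
  have h2 : (fibreIdIso (ofAbelianVariety A₀)).inv.hom.hom.hom ≫ (fibreIdIso (ofAbelianVariety A₀)).hom.hom.hom.hom =
      𝟙 _ :=
    congrArg (fun f => f.hom.hom.hom) (fibreIdIso (ofAbelianVariety A₀)).inv_hom_id
  rw [hj, hj', AlgPoints.map_apply, AlgPoints.map_apply]
  exact (Category.assoc _ _ _).trans ((congrArg (Q ≫ ·) h2).trans (Category.comp_id _))

/-- `pr₁⁻¹ (pr₁ P) = P` on `ℂ`-points. [cite: GortzWedhorn2020, Section (4.7) (p. 135)] -/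
theorem idFibre_pointsInv_hom_cancel
    (P : ((ofAbelianVariety A₀).fibre (𝟙 (Spec (CommRingCat.of ℂ)))).toAbelianVariety.Points ℂ) : j' (j P) = P := by
  have h1 : (fibreIdIso (ofAbelianVariety A₀)).hom.hom.hom.hom ≫ (fibreIdIso (ofAbelianVariety A₀)).inv.hom.hom.hom =
      𝟙 _ :=
    congrArg (fun f => f.hom.hom.hom) (fibreIdIso (ofAbelianVariety A₀)).hom_inv_id
  rw [hj', hj, AlgPoints.map_apply, AlgPoints.map_apply]
  exact (Category.assoc _ _ _).trans ((congrArg (P ≫ ·) h1).trans (Category.comp_id _))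

end IdFibre

section IdClause

variable (A₀ : AbelianVariety ℂ) {κ : Type} [Fintype κ] [DecidableEq κ]

/-- **The analytic type is a polarisation type** (`0 < δᵢ`, `δ₁ ∣ ⋯ ∣ δ_g`): positivity from the non-degeneracy of a
Riemann form (`det G = (∏ δᵢ)² ≠ 0`, ★ `IsRiemannForm.det_intGram_ne_zero`), the chain is part of the analytic type.
[cite: Lange2023AbelianVarietiesComplex, §1.5.1 (p. 51)] -/
theorem isPolarizationType_of_complexTorus_isPolarizationType {E : Type} [NormedAddCommGroup E] [NormedSpace ℂ E]
    [FiniteDimensional ℂ E] {Φ : (κ → ℝ) ≃L[ℝ] E} {ω : E [⋀^Fin 2]→L[ℝ] ℝ} (hR : IsRiemannForm Φ ω) {g : ℕ} {δ : Fin g → ℕ}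
    (hd : ComplexTorus.IsPolarizationType Φ ω δ) : ModuliOfAbelianVarieties.IsPolarizationType δ := by
  have hG : (intGram Φ ω).map (Int.cast : ℤ → ℝ) = latticeGram Φ ω := map_intGram Φ hR.isNSForm
  have hdet : (intGram Φ ω).det ≠ 0 := hR.det_intGram_ne_zero hG
  have hdpos : ∀ i, 0 < δ i := by
    have hprod : (∏ i, (δ i : ℝ)) ^ 2 ≠ 0 := by
      rw [← hd.det_latticeGram, ← hG, ← Int.cast_det]
      exact_mod_cast hdet
    intro i
    have hi : (δ i : ℝ) ≠ 0 := fun hz =>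
      hprod (by rw [Finset.prod_eq_zero (Finset.mem_univ i) hz, zero_pow two_ne_zero])
    exact Nat.pos_of_ne_zero (by exact_mod_cast hi)
  exact ⟨hdpos, hd.1⟩

/-- **`(∏ᵢ ℤ/δᵢ)² ≃ K(Θ₀)(ℂ)`** from the analytic type: `K(D) ≃ K(H)` (★ `IsPolarizationType.nonempty_kerPhiH_equiv`,
[Lange2023] §3.2.1) and `K(H) ≃ K(Θ₀)` along the uniformisation (★ `nonempty_kerPhiH_addEquiv_KTheta`, Lange (1.14)).
[cite: Lange2023AbelianVarietiesComplex, §3.2.1 (p. 165) and §1.4.2 (1.14)] [cite: MumfordAV1970, §23] -/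
theorem nonempty_levelGroup_mulEquiv_KTheta {Φ : (κ → ℝ) ≃L[ℝ] (Fin A₀.dim → ℂ)}
    {φ : ComplexTorus Φ → ComplexPoints A₀.X} (hφ : IsAnalytification (Fin A₀.dim → ℂ) A₀.X A₀.dim φ)
    (hadd : ∀ x y, φ (x + y) = φ x * φ y) (Θ₀ : CartierDivisor A₀.X.left) (p : AHData Φ)
    (hp : AHData.toPic p = picClass (cartierDivisorLineBundle hφ Θ₀)) (hR : IsRiemannForm Φ p.form) {g : ℕ}
    {δ : Fin g → ℕ} (hd : ComplexTorus.IsPolarizationType Φ p.form δ) :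
    Nonempty (Multiplicative (LevelGroup δ) ≃* A₀.KTheta Θ₀) := by
  have hG : (intGram Φ p.form).map (Int.cast : ℤ → ℝ) = latticeGram Φ p.form := map_intGram Φ p.isNSForm_form
  obtain ⟨eD⟩ := hd.nonempty_kerPhiH_equiv hR hG
  obtain ⟨eK⟩ := A₀.nonempty_kerPhiH_addEquiv_KTheta hφ hadd Θ₀ p hp
  exact ⟨AddEquiv.toMultiplicativeLeft (eD.symm.trans eK)⟩

/-- **The `HasType δ` clause at the identity point**: an injective homomorphism `(∏ᵢ ℤ/δᵢ)² → A₁(ℂ)` with image the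
kernel of `λ̄` on `ℂ`-points — `K(D) ≃ K(Θ₀)(A₀) ≃ K(Θ₁)(A₁) = ker λ̄(ℂ)` (★ `mem_kerPointsAt_iff_mem_KTheta`).
[cite: MumfordFogartyKirwan1994, App. 7A (pp. 234–235)] [cite: Lange2023AbelianVarietiesComplex, §3.2.1 (p. 165)] -/
theorem exists_monoidHom_range_eq_kerPointsAt_id {D : (ofAbelianVariety A₀).DualPair}
    (pol : (ofAbelianVariety A₀).Polarization D) {g : ℕ} {δ : Fin g → ℕ} (Θ₀ : CartierDivisor A₀.X.left)
    (Θ₁ : CartierDivisor ((ofAbelianVariety A₀).fibre (𝟙 (Spec (CommRingCat.of ℂ)))).toAbelianVariety.X.left)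
    (hΘ₁ : Θ₁.cechClass = CechPic.pullback
      (pullback.fst (ofAbelianVariety A₀).X.hom (𝟙 (Spec (CommRingCat.of ℂ)))) Θ₀.cechClass)
    (hlam : (ofAbelianVariety A₀).IsLambdaOfAt (𝟙 (Spec (CommRingCat.of ℂ))) D pol.lam Θ₁)
    {Φ : (κ → ℝ) ≃L[ℝ] (Fin A₀.dim → ℂ)} {φ : ComplexTorus Φ → ComplexPoints A₀.X}
    (hφ : IsAnalytification (Fin A₀.dim → ℂ) A₀.X A₀.dim φ) (hadd : ∀ x y, φ (x + y) = φ x * φ y) (p : AHData Φ)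
    (hp : AHData.toPic p = picClass (cartierDivisorLineBundle hφ Θ₀)) (hR : IsRiemannForm Φ p.form)
    (hd : ComplexTorus.IsPolarizationType Φ p.form δ) :
    ∃ ψ : Multiplicative (LevelGroup δ) →*
        ((ofAbelianVariety A₀).fibre (𝟙 (Spec (CommRingCat.of ℂ)))).toAbelianVariety.Points ℂ,
      Injective ψ ∧ Set.range ψ = pol.kerPointsAt (𝟙 (Spec (CommRingCat.of ℂ))) := by
  obtain ⟨e⟩ := nonempty_levelGroup_mulEquiv_KTheta A₀ hφ hadd Θ₀ p hp hR hd
  obtain ⟨j, j', hj, hj'⟩ := exists_idFibre_pointsHom A₀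
  refine ⟨j'.comp ((A₀.KTheta Θ₀).subtype.comp e.toMonoidHom), ?_, ?_⟩
  · intro x y hxy
    have h := congrArg j hxy
    simp only [MonoidHom.comp_apply, idFibre_pointsHom_inv_cancel A₀ j j' hj hj'] at h
    exact e.injective (Subtype.ext h)
  · ext P
    rw [pol.mem_kerPointsAt_iff_mem_KTheta _ hlam P, mem_KTheta_idFibre_iff A₀ j hj Θ₀ Θ₁ hΘ₁ P]
    constructor
    · rintro ⟨x, rfl⟩
      simp only [MonoidHom.comp_apply, idFibre_pointsHom_inv_cancel A₀ j j' hj hj', Subgroup.subtype_apply]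
      exact (e x).2
    · intro hP
      refine ⟨e.symm ⟨_, hP⟩, ?_⟩
      simp only [MonoidHom.comp_apply, MulEquiv.coe_toMonoidHom, MulEquiv.apply_symm_apply, Subgroup.subtype_apply]
      exact idFibre_pointsInv_hom_cancel A₀ j j' hj hj' P

end IdClause

section GeomPoint

variable (A₀ : AbelianVariety ℂ) {Ω : Type} [Field Ω] (σ : ℂ →+* Ω)

/-- **Every `n`-torsion `L`-point of `A₀` is the extension of an `n`-torsion `ℂ`-point** (`L ⊇ ℂ` algebraically closed, `n ≠ 0`):
`A₀[n](ℂ) ↪ A₀[n](L)` injects between finite sets of equal size `n^{2g}` (★ `natCard_torsionPoints_eq_of_isAlgClosed`).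
[cite: MumfordAV1970, §6 Proposition p. 64] -/
theorem exists_extendScalars_eq_of_pow_eq_one [IsAlgClosed Ω] {n : ℕ} (hn : n ≠ 0) {b : A₀.Points (AlongHom Ω σ)}
    (hb : b ^ n = 1) : ∃ a : A₀.Points ℂ, AlgPoints.extendScalars A₀.X ℂ (AlongHom Ω σ) a = b := by
  haveI : IsAlgClosed (AlongHom Ω σ) := ‹IsAlgClosed Ω›
  have hnz : ((n : ℤ) : ℂ) ≠ 0 := by exact_mod_cast hn
  let f : A₀.torsionPoints ℂ (n : ℤ) → A₀.torsionPoints (AlongHom Ω σ) (n : ℤ) := fun a =>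
    ⟨AlgPoints.extendScalars A₀.X ℂ (AlongHom Ω σ) a.1, by
      rw [AbelianVariety.mem_torsionPoints_iff, ← AlgPoints.extendScalarsMonoidHom_apply, ← map_zpow,
        (A₀.mem_torsionPoints_iff _ _).1 a.2, map_one]⟩
  have hf : Injective f := fun a a' h =>
    Subtype.ext (AlgPoints.extendScalars_injective A₀.X (L := ℂ) (L' := AlongHom Ω σ) (congrArg Subtype.val h))
  haveI : Finite (A₀.torsionPoints (AlongHom Ω σ) (n : ℤ)) := by
    apply Nat.finite_of_card_ne_zero
    rw [A₀.natCard_torsionPoints_eq_of_isAlgClosed (AlongHom Ω σ) n hnz]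
    exact pow_ne_zero _ (by simpa using hn)
  have hcard : Nat.card (A₀.torsionPoints (AlongHom Ω σ) (n : ℤ)) ≤ Nat.card (A₀.torsionPoints ℂ (n : ℤ)) := by
    rw [A₀.natCard_torsionPoints_eq_of_isAlgClosed (AlongHom Ω σ) n hnz, A₀.natCard_torsionPoints_eq_of_isAlgClosed ℂ n hnz]
  have hb' : b ∈ A₀.torsionPoints (AlongHom Ω σ) (n : ℤ) := by
    rw [AbelianVariety.mem_torsionPoints_iff, zpow_natCast]; exact hb
  obtain ⟨a, ha⟩ := (hf.bijective_of_nat_card_le hcard).2 ⟨b, hb'⟩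
  exact ⟨a.1, congrArg Subtype.val ha⟩

variable (j : ((ofAbelianVariety A₀).fibre (𝟙 (Spec (CommRingCat.of ℂ)))).toAbelianVariety.Points ℂ →* A₀.Points ℂ)
  (j' : A₀.Points ℂ →* ((ofAbelianVariety A₀).fibre (𝟙 (Spec (CommRingCat.of ℂ)))).toAbelianVariety.Points ℂ)
  (hj : ∀ P, j P = AlgPoints.map (fibreIdIso (ofAbelianVariety A₀)).hom.hom.hom.hom P)
  (hj' : ∀ Q, j' Q = AlgPoints.map (fibreIdIso (ofAbelianVariety A₀)).inv.hom.hom.hom Q)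
  (E : ((ofAbelianVariety A₀).fibre (𝟙 (Spec (CommRingCat.of ℂ)))).toAbelianVariety.Points ℂ →*
    ((ofAbelianVariety A₀).fibre (Spec.map (CommRingCat.ofHom σ))).toAbelianVariety.Points Ω)
  (hE : ∀ P, E P = A₀.pointsEquiv (AlongHom Ω σ) (AlgPoints.extendScalars A₀.X ℂ (AlongHom Ω σ) (j P)))
  {D : (AbelianSchemeOver.ofAbelianVariety A₀).DualPair} (pol : (AbelianSchemeOver.ofAbelianVariety A₀).Polarization D)

include hE

/-- **The extension of points `E : A₁(ℂ) → A_s(Ω)`** for `s = Spec σ` — `pr₁ : A₁ → A₀`, then `A₀(ℂ) → A₀(L)` (extension of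
scalars, `L = Ω` as a `ℂ`-algebra through `σ`, ★ `AlongHom`), then `A₀(L) ≃ A_L(L) = A_s(Ω)` (★ `pointsEquiv`; `A_s` IS
`A₀ ×_{ℂ,σ} L` on the nose) — lies over `Spec σ ≫ pr₁ P₀` (★ `pointsEquiv_apply_left_comp_fst`).
[cite: GortzWedhorn2020, Section (4.7) (points of a base change)] -/
theorem fibrePointToLeft_fibrePointsExtend
    (P₀ : ((ofAbelianVariety A₀).fibre (𝟙 (Spec (CommRingCat.of ℂ)))).toAbelianVariety.Points ℂ) :
    (ofAbelianVariety A₀).fibrePointToLeft (Spec.map (CommRingCat.ofHom σ)) (E P₀) =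
      Spec.map (CommRingCat.ofHom σ) ≫ (j P₀).left := by
  rw [hE P₀]
  exact A₀.pointsEquiv_apply_left_comp_fst (AlongHom Ω σ) (AlgPoints.extendScalars A₀.X ℂ (AlongHom Ω σ) (j P₀))

include hj

/-- **`E P₀ ∈ ker λ̄(Ω) ↔ P₀ ∈ ker λ̄(ℂ)`**: both say `pr₁ P₀ ≫ λ = 1 ≫ λ` as points of `D.hat`, the `Ω`-side after composing
with the epimorphism `Spec Ω → Spec ℂ` (★ `AlgPoints.epi_specMap_algebraMap`).
[cite: MumfordFogartyKirwan1994, App. 7A (pp. 234–235)] [cite: Hartshorne1977, II Ex. 2.7] -/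
theorem fibrePointsExtend_mem_kerPointsAt_iff
    (P₀ : ((ofAbelianVariety A₀).fibre (𝟙 (Spec (CommRingCat.of ℂ)))).toAbelianVariety.Points ℂ) :
    E P₀ ∈ pol.kerPointsAt (Spec.map (CommRingCat.ofHom σ)) ↔ P₀ ∈ pol.kerPointsAt (𝟙 (Spec (CommRingCat.of ℂ))) := by
  have hv : ∀ Q : ((ofAbelianVariety A₀).fibre (𝟙 (Spec (CommRingCat.of ℂ)))).toAbelianVariety.Points ℂ,
      pol.valueAt (Spec.map (CommRingCat.ofHom σ)) (E Q) = (Spec.map (CommRingCat.ofHom σ) ≫ (j Q).left) ≫ pol.lam.left := by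
    intro Q
    change (ofAbelianVariety A₀).fibrePointToLeft _ (E Q) ≫ pol.lam.left = _
    rw [fibrePointToLeft_fibrePointsExtend A₀ σ j E hE]
    rfl
  have hv₁ : ∀ Q : ((ofAbelianVariety A₀).fibre (𝟙 (Spec (CommRingCat.of ℂ)))).toAbelianVariety.Points ℂ,
      pol.valueAt (𝟙 (Spec (CommRingCat.of ℂ))) Q = (j Q).left ≫ pol.lam.left := by
    intro Q
    change (Q.left ≫ pullback.fst _ _) ≫ pol.lam.left = _
    rw [hj Q, AlgPoints.map_apply, Over.comp_left]
    erw [fibreIdToGrpIso_hom_left]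
    rfl
  rw [pol.mem_kerPointsAt_iff, pol.mem_kerPointsAt_iff, ← map_one E, hv, hv, hv₁, hv₁]
  haveI : Epi (Spec.map (CommRingCat.ofHom σ)) := AlgPoints.epi_specMap_algebraMap ℂ (AlongHom Ω σ)
  constructor
  · intro h
    exact (cancel_epi (Spec.map (CommRingCat.ofHom σ))).mp
      (((Category.assoc _ _ _).symm.trans h).trans (Category.assoc _ _ _))
  · intro h
    exact ((Category.assoc _ _ _).trans (congrArg (Spec.map (CommRingCat.ofHom σ) ≫ ·) h)).trans
      (Category.assoc _ _ _).symm

include hj'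

/-- `E` is injective (★ `AlgPoints.extendScalars_injective`, `pr₁` bijective). [cite: Hartshorne1977, II Ex. 2.7] -/
theorem fibrePointsExtend_injective : Injective E := by
  intro x y hxy
  rw [hE, hE] at hxy
  have h : j x = j y :=
    AlgPoints.extendScalars_injective A₀.X (L := ℂ) (L' := AlongHom Ω σ) ((A₀.pointsEquiv (AlongHom Ω σ)).injective hxy)
  rw [← idFibre_pointsInv_hom_cancel A₀ j j' hj hj' x, h, idFibre_pointsInv_hom_cancel A₀ j j' hj hj' y]

/-- **Every point of `ker λ̄(Ω)` comes from `A₁(ℂ)` under `E`**: `ker λ̄(Ω) = K(Θ_s)(Ω)` for the ample `Θ_s` of `pol.exists_ample`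
(★ `mem_kerPointsAt_iff_mem_KTheta`) is finite of exponent `n = #K(Θ_s)` (★ `pow_natCard_KTheta_eq_one`), and `n`-torsion
over `Ω ⊇ ℂ` comes from `ℂ`. [cite: MumfordFogartyKirwan1994, App. 7A (pp. 234–235)]
[cite: MumfordAV1970, §6 Application 1 and Proposition p. 64] -/
theorem exists_fibrePointsExtend_eq_of_mem_kerPointsAt [IsAlgClosed Ω]
    {P' : ((ofAbelianVariety A₀).fibre (Spec.map (CommRingCat.ofHom σ))).toAbelianVariety.Points Ω}
    (hP' : P' ∈ pol.kerPointsAt (Spec.map (CommRingCat.ofHom σ))) : ∃ P₀, E P₀ = P' := by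
  obtain ⟨Θs, hamp, hlams⟩ := pol.exists_ample Ω (Spec.map (CommRingCat.ofHom σ))
  have hK := (pol.mem_kerPointsAt_iff_mem_KTheta _ hlams P').1 hP'
  have hn : 0 < Nat.card (((ofAbelianVariety A₀).fibre (Spec.map (CommRingCat.ofHom σ))).toAbelianVariety.KTheta Θs) :=
    ((ofAbelianVariety A₀).fibre (Spec.map (CommRingCat.ofHom σ))).toAbelianVariety.natCard_KTheta_pos hamp
  have hPn := ((ofAbelianVariety A₀).fibre (Spec.map (CommRingCat.ofHom σ))).toAbelianVariety.pow_natCard_KTheta_eq_one hK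
  -- read `P'` as an `L`-point of `A₀`, `L = Ω` through `σ`
  let b : A₀.Points (AlongHom Ω σ) := (A₀.pointsMulEquiv (AlongHom Ω σ)).symm P'
  have hb : b ^ Nat.card (((ofAbelianVariety A₀).fibre (Spec.map (CommRingCat.ofHom σ))).toAbelianVariety.KTheta Θs) = 1 := by
    change ((A₀.pointsMulEquiv (AlongHom Ω σ)).symm P') ^ _ = 1
    rw [← map_pow]
    exact (map_eq_one_iff _ (A₀.pointsMulEquiv (AlongHom Ω σ)).symm.injective).2 hPn
  obtain ⟨a, ha⟩ := exists_extendScalars_eq_of_pow_eq_one A₀ σ hn.ne' hb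
  refine ⟨j' a, ?_⟩
  rw [hE, idFibre_pointsHom_inv_cancel A₀ j j' hj hj', ha]
  exact (A₀.pointsMulEquiv (AlongHom Ω σ)).apply_symm_apply P'

end GeomPoint

/-- **U-a4 (F2): analytic type `δ` of `c₁(𝒪(Θ₀)^an)` ⇒ `pol.HasType δ`** (converse companion of ★
`HasType.complexTorus_isPolarizationType`; the text of the cell's socket v2 verbatim).  At the identity point: §2; at
`s = Spec σ : Spec Ω → Spec ℂ` the fibre `A_s` IS `A₀ ×_{ℂ,σ} Ω` (★ `AlongHom`) and the extension of points `E` carries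
`ker λ̄(ℂ)` injectively onto `ker λ̄(Ω)` (§3). [cite: MumfordFogartyKirwan1994, App. 7A (pp. 234–235)]
[cite: Lange2023AbelianVarietiesComplex, §3.2.1 (p. 165)] [cite: MumfordAV1970, §23 (type of a polarisation)] -/
theorem hasType_of_complexTorus_isPolarizationType (A₀ : AbelianVariety ℂ)
    (D : (ofAbelianVariety A₀).DualPair) (pol : (ofAbelianVariety A₀).Polarization D) (g : ℕ) (δ : Fin g → ℕ)
    (Θ₀ : CartierDivisor A₀.X.left)
    (Θ₁ : CartierDivisor ((ofAbelianVariety A₀).fibre (𝟙 (Spec (CommRingCat.of ℂ)))).toAbelianVariety.X.left)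
    (hΘ₁ : Θ₁.cechClass = CechPic.pullback
      (pullback.fst (ofAbelianVariety A₀).X.hom (𝟙 (Spec (CommRingCat.of ℂ)))) Θ₀.cechClass)
    (hlam : (ofAbelianVariety A₀).IsLambdaOfAt (𝟙 (Spec (CommRingCat.of ℂ))) D pol.lam Θ₁)
    (κ : Type) [Fintype κ] [DecidableEq κ] (Φ : (κ → ℝ) ≃L[ℝ] (Fin A₀.dim → ℂ))
    (φ : ComplexTorus Φ → ComplexPoints A₀.X) (hφ : IsAnalytification (Fin A₀.dim → ℂ) A₀.X A₀.dim φ)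
    (hadd : ∀ x y, φ (x + y) = φ x * φ y) (_hg : A₀.dim = g)
    (p : AHData Φ) (hp : AHData.toPic p = picClass (cartierDivisorLineBundle hφ Θ₀)) (hR : IsRiemannForm Φ p.form)
    (hd : ComplexTorus.IsPolarizationType Φ p.form δ) : pol.HasType δ := by
  refine ⟨isPolarizationType_of_complexTorus_isPolarizationType hR hd, fun Ω _ _ s => ?_⟩
  obtain ⟨ψ, hψ, hrange⟩ := exists_monoidHom_range_eq_kerPointsAt_id A₀ pol Θ₀ Θ₁ hΘ₁ hlam hφ hadd p hp hR hd
  obtain ⟨σ, rfl⟩ : ∃ σ : ℂ →+* Ω, Spec.map (CommRingCat.ofHom σ) = s :=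
    ⟨(Spec.preimage s).hom, Spec.map_preimage s⟩
  obtain ⟨j, j', hj, hj'⟩ := exists_idFibre_pointsHom A₀  -- `pr₁`, `pr₁⁻¹`; next `E = (A₀(L) ≃ A_L(L)) ∘ ext ∘ pr₁`
  obtain ⟨E, hE⟩ : ∃ E : ((ofAbelianVariety A₀).fibre (𝟙 (Spec (CommRingCat.of ℂ)))).toAbelianVariety.Points ℂ →*
      ((ofAbelianVariety A₀).fibre (Spec.map (CommRingCat.ofHom σ))).toAbelianVariety.Points Ω,
      ∀ P, E P = A₀.pointsEquiv (AlongHom Ω σ) (AlgPoints.extendScalars A₀.X ℂ (AlongHom Ω σ) (j P)) :=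
    ⟨((A₀.pointsMulEquiv (AlongHom Ω σ)).toMonoidHom.comp
        (AlgPoints.extendScalarsMonoidHom A₀.X ℂ (AlongHom Ω σ))).comp j, fun _ => rfl⟩
  refine ⟨E.comp ψ, (fibrePointsExtend_injective A₀ σ j j' hj hj' E hE).comp hψ, ?_⟩
  ext P'
  constructor
  · rintro ⟨x, rfl⟩
    rw [MonoidHom.comp_apply, fibrePointsExtend_mem_kerPointsAt_iff A₀ σ j hj E hE pol, ← hrange]
    exact ⟨x, rfl⟩
  · intro hP'
    obtain ⟨P₀, rfl⟩ := exists_fibrePointsExtend_eq_of_mem_kerPointsAt A₀ σ j j' hj hj' E hE pol hP'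
    have hP₀ := (fibrePointsExtend_mem_kerPointsAt_iff A₀ σ j hj E hE pol P₀).1 hP'
    rw [← hrange] at hP₀
    obtain ⟨x, rfl⟩ := hP₀
    exact ⟨x, rfl⟩

end Literature.AlgebraicGeometry.AbelianVarieties

end
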